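import Summits.QuantumFields.YangMills.Theorems.BalabanUVNodesN11NoExpansionTruncatedWitness
import Literature.MathematicalPhysics.QuantumFieldTheory.Balaban1983to89.Node00.Record13CoPH

/-!
# DAG node N11 — DEFINITIONS: THE §2 WITNESS TRUNCATED ABOVE A LEVEL (`truncAbove k t`) and [III] §3's DELIVERABLE AT LEVEL `k` AS ONE NAMED PREDICATE
# (`Sect3SupplyAt θ p k`): for every exposed witness of the §2 form of `ρ_k`, a 𝐓-image candidate family — universal in 𝐄, keeping the old terms, no new `𝐑 ∕ 𝐁` and
# `E_{k+1} = E_k` at the no-expansion sequences — with the laws `Sect2.LawsT … k` AND the 𝐓-image clause AT THE EXPANSION SEQUENCES `Ω_{k+1}(s′) ≠ ∅`; and dag-n11-d's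
# NO-EXPANSION 𝐓-STEP AT LEVEL `k` as one named predicate (`NoExpansionTStepAt θ p k`): the 𝐓-image clause at the sequences `Ω_{k+1}(s′) = ∅` for some exposed witness

HEADER — WORK-UNIT METADATA.  Cell `pub-ymgap`, YM-PLAN Track A (HUMAN RULING D-0062), seat `pub-ymgap-dag-n11-e` (g14; R134 fan-out seat N11 [B14], strategy s3
«`ThmP245Printed` via `rOperation`»), route `BalabanUVNodes` rev 25 (v1.7 `CoPH` key), item K1⁷ `StabilityBAtRecordR13SepCoPH` = stmt-QuantumFields-20542; DEFINITION lane
(`--kind definition --supports 20542 --as helper`), count-neutral.  [III] = [Balaban1988Convergent], [IV] = [Balaban1989LargeFieldI].  Over 11b ∕ 11c ∕ def-T v1.7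
(`Node00.Sect2FrameOfRecord`, `Sect2FormOfRecord`, `Record13CoPH`: `Sect2.TermValues`, `towerOfTerms`, `HasSect2FormAtZS`, `slotsOfRecord ∕ slotsTOfRecord`, `sect2Slot`,
`WtOfRecord₁₃H`, `Stage13HParams.rzAt`) and this seat's `…NoExpansionTruncatedWitness` (p549689).

WHY THIS FILE.  This seat's reductions of Theorem 1's inductive step `ρ_k ↦ ρ_{k+1}` (`…StepReductionCoPH` p552803 → `…IntegrableCoPH` p565152 → `…RePinnedIntegrableCoPH`
p566247 → `…RePinnedUnivECoPH`, g14) expose WHAT [III] §3 HAS TO DELIVER at a level `k`, relative to the exposed witness `(t, E_k)` of the §2 form of `ρ_k`: a candidate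
𝐓-image family `(tT, EkT)` over the sequences of length `k+1`, UNIVERSAL in its 𝐄-component ((2.25)–(2.27): the `𝐄^{(j)}(X, ·, z)` carry no sequence argument), which at
the no-expansion sequences keeps the old terms, has no `𝐑^{(k+1)} ∕ 𝐁^{(k+1)}` and `E_{k+1} = E_k` (print §2 p. 262 ∕ (3.25): no new terms along a large-field step), and
which AT THE EXPANSION SEQUENCES `Ω_{k+1}(s′) ≠ ∅` obeys the 𝐓-image laws `Sect2.LawsT … k` (old terms as at `k`, r11's `LFNewTerms … k`, analyticity through `k+1`) and the
𝐓-image clause `𝐓ρ_k(s′) = 𝐓_k(s′) exp A_{k+1}(s′)` a.e. on the support of `χ_{k+1}(s′)` — [III] Sect. 1 ∕ §3 ∕ Thm 2 proper.  Until now that deliverable was a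
40-line hypothesis block repeated in every reduction; the successor file (`…ThmP245OfSect3SupplyCoPH`) keys N11's (S1ᵀ) slot `∀ k < K, SLaw_k → TLaw_k` (= the Theorem
of p. 245 at the record, `B14NodeKnitRecord13RCoPH.thmP245PrintedI_at_record₁₃CoPH_iff_laws`) on it level by level, so it is NAMED here: `Sect3SupplyAt θ p k`.  Also named:
the witness TRUNCATED ABOVE LEVEL `k` (`truncAbove k t`: `𝐄 ∕ 𝐑 ∕ 𝐁` kept at the levels `≤ k`, zero above) — the candidate that serves every sequence when no sequence of
length `k+1` expands, and the A6 inhabitant of the bookkeeping half of the supply.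

WHAT THIS FILE DEFINES ∕ PROVES (1 `def` (function) + 1 `def … : Prop` (a bookkeeping predicate with parameters — the SHAPE of a deliverable, NOT a cited result and NOT
claimed inhabited); theorems otherwise; 0 `sorry`, standard axioms).
§1 `truncAbove k t`; faces `truncAbove_E ∕ _R ∕ _B` (`rfl`), `_E_of_le ∕ _R_of_le ∕ _B_of_le`, `_E_of_lt ∕ _R_of_lt ∕ _B_of_lt`, `universalE_truncAbove_comp`; LAW TRANSPORT
   `lawsT_towerOfTerms_truncAbove_of_lawsRT` (p549689's `lawsT_towerOfTerms_of_lawsRT_of_agree_of_vanish` at `t′ := truncAbove k t`: the truncated witness obeys the 𝐓-image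
   laws from the inductive assumptions, the RG equation and the signs `0 ≤ E₀, B₀, g_{k+1}`).
§2 `Sect3SupplyAt θ p k` (generic `θ : Stage13HParams`, the run's OWN history-indexed weights `WtOfRecord₁₃H θ p`; at `rePinH θ` it is — by `rfl` on `rePinH`'s Stage-13
   part and `rzAt_rePinH` — exactly p566247's hypothesis block `tT, EkT, huT, hold, hnoR, hnoB, hEk, hexp`) · `NoExpansionTStepAt θ p k` (the complementary deliverable:
   `SLaw₁₃CoPH θ p k ⇒` some exposed witness carries the 𝐓-image clause at every no-expansion sequence — dag-n11-d's witness-first face at `rePinH θ`, modulo their binders).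
   The successor file proves N11's (S1ᵀ) slot, Theorem 1 at all levels and the node sentences from `∀ k < K, Sect3SupplyAt θ p k ∧ NoExpansionTStepAt θ p k` — generic `θ`.

HONEST FRAMING.  Definitions and bookkeeping; `Sect3SupplyAt` ∕ `NoExpansionTStepAt` are NOT claimed for any `θ`, run or level (the first IS [III] §3's content at the expansion
sequences, the second is dag-n11-d's no-expansion 𝐓-step, in the tree at `rePinH θ` modulo the old-branch measurability ∕ integrability of a `k`-local witness); nothing
of Bałaban asserted; N11 NOT discharged; K1⁷ NOT closed; counts unmoved (typed 28∕28 · discharged 5∕27).  One finite `𝕋⁴_{L^K}` programme at fixed `ε = L^{−K}`; NOT ℝ⁴,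
NOT OS, NOT a mass gap, NOT Clay.  No `sorry`, no `axiom`, no `instance`, no `notation`.
Sources: [III] Theorem p.245, Thm 1 p.262, §2 p.262, (2.17)–(2.18) p.257, (2.20)–(2.31) pp.258–260, (2.40)–(2.42) p.261, (3.24)–(3.25) p.270, p.279; [Balaban1987RG1] (0.20) p.256.
-/

noncomputable section

open MeasureTheory
open scoped BigOperators Matrix.Norms.L2Operator

namespace Summit.QuantumFields.YangMills.Theorems.BalabanUVNodesN11Sect3SupplyDefs

open Literature.MathematicalPhysics.QuantumFieldTheory.Balaban1983to89 T4Continuum Node00 Node00.Tk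
open Step B14.Eq227LocalizedTerms
open BalabanUVNodesN11NoExpansionTruncatedWitness (lawsT_towerOfTerms_of_lawsRT_of_agree_of_vanish)

/-! ## §1  The §2 witness truncated above a level -/

section TruncAbove

variable {P : Params} {𝔸 : Type*} {V : Type*} {M : ℕ}

/-- **THE TERM VALUES TRUNCATED ABOVE LEVEL `k`**: `𝐄^{(j)} ∕ 𝐑^{(j)} ∕ 𝐁^{(j)}` of `t` at the levels `j ≤ k`, ZERO at the levels `j > k` — the candidate 𝐓-image witness
along a step with no new terms (print §2 p. 262 ∕ (3.25): at a large-field step `𝐓` creates no `𝐄^{(k+1)}, 𝐑^{(k+1)}, 𝐁^{(k+1)}` for the sequence; the §2 form at index `k`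
reads the levels `≤ k` only). [cite: Balaban1988Convergent, §2 p.262, (2.23) p.258, (3.25) p.270 (bookkeeping)] -/
def truncAbove (k : ℕ) (t : Sect2.TermValues P 𝔸 V M) : Sect2.TermValues P 𝔸 V M where
  E j X z g φ := if j ≤ k then t.E j X z g φ else 0
  R j X φ := if j ≤ k then t.R j X φ else 0
  B j X φ a := if j ≤ k then t.B j X φ a else 0

/-- Unfolding of the 𝐄-component (`rfl`). [cite: Balaban1988Convergent, (2.25) p.259 (bookkeeping)] -/
theorem truncAbove_E (k : ℕ) (t : Sect2.TermValues P 𝔸 V M) (j : ℕ) (X : (Sect2.domSys P M j).Dom) (z : Site P j) (g : ℝ) (φ : Sect2.CPair P 𝔸) :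
    (truncAbove k t).E j X z g φ = if j ≤ k then t.E j X z g φ else 0 := rfl

/-- Unfolding of the 𝐑-component (`rfl`). [cite: Balaban1988Convergent, (2.30) p.260 (bookkeeping)] -/
theorem truncAbove_R (k : ℕ) (t : Sect2.TermValues P 𝔸 V M) (j : ℕ) (X : (Sect2.domSys P M j).Dom) (φ : Sect2.CPair P 𝔸) :
    (truncAbove k t).R j X φ = if j ≤ k then t.R j X φ else 0 := rfl

/-- Unfolding of the 𝐁-component (`rfl`). [cite: Balaban1988Convergent, (2.40) p.261 (bookkeeping)] -/
theorem truncAbove_B (k : ℕ) (t : Sect2.TermValues P 𝔸 V M) (j : ℕ) (X : (Sect2.domSys P M j).Dom) (φ : Sect2.CPair P 𝔸) (a : SFluct P V) :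
    (truncAbove k t).B j X φ a = if j ≤ k then t.B j X φ a else 0 := rfl

/-- At the levels `≤ k` the truncation keeps `𝐄`. [cite: Balaban1988Convergent, §2 p.262 (bookkeeping)] -/
theorem truncAbove_E_of_le {k : ℕ} (t : Sect2.TermValues P 𝔸 V M) {j : ℕ} (hj : j ≤ k) (X : (Sect2.domSys P M j).Dom) (z : Site P j) (g : ℝ)
    (φ : Sect2.CPair P 𝔸) : (truncAbove k t).E j X z g φ = t.E j X z g φ := if_pos hj

/-- At the levels `≤ k` the truncation keeps `𝐑`. [cite: Balaban1988Convergent, §2 p.262 (bookkeeping)] -/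
theorem truncAbove_R_of_le {k : ℕ} (t : Sect2.TermValues P 𝔸 V M) {j : ℕ} (hj : j ≤ k) (X : (Sect2.domSys P M j).Dom) (φ : Sect2.CPair P 𝔸) :
    (truncAbove k t).R j X φ = t.R j X φ := if_pos hj

/-- At the levels `≤ k` the truncation keeps `𝐁`. [cite: Balaban1988Convergent, §2 p.262 (bookkeeping)] -/
theorem truncAbove_B_of_le {k : ℕ} (t : Sect2.TermValues P 𝔸 V M) {j : ℕ} (hj : j ≤ k) (X : (Sect2.domSys P M j).Dom) (φ : Sect2.CPair P 𝔸) (a : SFluct P V) :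
    (truncAbove k t).B j X φ a = t.B j X φ a := if_pos hj

/-- Above the level `k` the truncated `𝐄` vanishes. [cite: Balaban1988Convergent, (3.25) p.270 (bookkeeping)] -/
theorem truncAbove_E_of_lt {k : ℕ} (t : Sect2.TermValues P 𝔸 V M) {j : ℕ} (hj : k < j) (X : (Sect2.domSys P M j).Dom) (z : Site P j) (g : ℝ)
    (φ : Sect2.CPair P 𝔸) : (truncAbove k t).E j X z g φ = 0 := if_neg (Nat.not_le.mpr hj)

/-- Above the level `k` the truncated `𝐑` vanishes. [cite: Balaban1988Convergent, (3.25) p.270 (bookkeeping)] -/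
theorem truncAbove_R_of_lt {k : ℕ} (t : Sect2.TermValues P 𝔸 V M) {j : ℕ} (hj : k < j) (X : (Sect2.domSys P M j).Dom) (φ : Sect2.CPair P 𝔸) :
    (truncAbove k t).R j X φ = 0 := if_neg (Nat.not_le.mpr hj)

/-- Above the level `k` the truncated `𝐁` vanishes. [cite: Balaban1988Convergent, (3.25) p.270 (bookkeeping)] -/
theorem truncAbove_B_of_lt {k : ℕ} (t : Sect2.TermValues P 𝔸 V M) {j : ℕ} (hj : k < j) (X : (Sect2.domSys P M j).Dom) (φ : Sect2.CPair P 𝔸) (a : SFluct P V) :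
    (truncAbove k t).B j X φ a = 0 := if_neg (Nat.not_le.mpr hj)

/-- **UNIVERSALITY IN 𝐄 TRANSPORTS** along any re-indexing: if `t` is universal in its 𝐄-component, so is `i ↦ truncAbove k (t (f i))` (e.g. `f = init` from the sequences of
length `k+1` to those of length `k`). [cite: Balaban1988Convergent, (2.25)–(2.27) p.259 (bookkeeping)] -/
theorem universalE_truncAbove_comp {ι κ : Type*} {t : ι → Sect2.TermValues P 𝔸 V M} (h : Sect2.UniversalE t) (k : ℕ) (f : κ → ι) :
    Sect2.UniversalE fun i => truncAbove k (t (f i)) := by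
  intro i i'
  funext j X z g φ
  show (if j ≤ k then (t (f i)).E j X z g φ else 0) = if j ≤ k then (t (f i')).E j X z g φ else 0
  rw [h (f i) (f i')]

variable [NormedRing 𝔸] [NormedAlgebra ℂ 𝔸] [CompleteSpace 𝔸] {G : Type*} [GaugeGroup G]

/-- **THE TRUNCATED WITNESS OBEYS THE 𝐓-IMAGE LAWS** (this seat's `…TruncatedWitness.lawsT_towerOfTerms_of_lawsRT_of_agree_of_vanish` at `t′ := truncAbove k t`): from the
inductive assumptions `Sect2.LawsRT … k` of `t` on a frame `(S, Rz, M, Ω)`, the RG equation at `k` and the signs `0 ≤ E₀, B₀`, `0 ≤ g_{k+1}` — r11's new-term obligations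
and analyticity at `k+1` hold for the ZERO values. [cite: Balaban1988Convergent, §2 p.262, (2.27)–(2.31) pp.259–260, (2.41)–(2.42) p.261, (3.25) p.270; Balaban1987RG1, (0.20) p.256] -/
theorem lawsT_towerOfTerms_truncAbove_of_lawsRT (S : Sect2.Setting 𝔸 G) (Rz : Sect2.Residual P 𝔸) (Ω : ℕ → Set (Site P 0)) {k : ℕ}
    {t : Sect2.TermValues P 𝔸 V M} (h : Sect2.LawsRT (Sect2.towerOfTerms S Rz M Ω t) S.lf k)
    (hrg : 1 / (S.flow.g k) ^ 2 = 1 / (S.flow.g (k + 1)) ^ 2 + S.flow.β (k + 1) (S.flow.g k))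
    (hE₀ : 0 ≤ S.lf.E₀) (hB₀ : 0 ≤ S.lf.B₀) (hg : 0 ≤ S.flow.g (k + 1)) :
    Sect2.LawsT (Sect2.towerOfTerms S Rz M Ω (truncAbove k t)) S.lf S.βc k :=
  lawsT_towerOfTerms_of_lawsRT_of_agree_of_vanish S Rz Ω (fun _ hj X z g φ => truncAbove_E_of_le t hj X z g φ) (fun _ hj X φ => truncAbove_R_of_le t hj X φ)
    (fun _ hj X φ a => truncAbove_B_of_le t hj X φ a) (fun X z g φ => truncAbove_E_of_lt t (Nat.lt_succ_self k) X z g φ)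
    (fun X φ => truncAbove_R_of_lt t (Nat.lt_succ_self k) X φ) (fun X φ a => truncAbove_B_of_lt t (Nat.lt_succ_self k) X φ a) h hrg hE₀ hB₀ hg

end TruncAbove

/-! ## §2  [III] §3's deliverable at level `k`, named -/

section Supply

variable {F : T4Family} {N : ℕ} [NeZero N]

/-- **[III] §3's DELIVERABLE AT LEVEL `k`** for the run `p` at the v1.7 parameter `θ` (the run's own history-indexed residual `θ.rzAt p` and weights `WtOfRecord₁₃H θ p`):
for EVERY exposed witness `(t, E_k)` of the §2 form of `ρ_k` (`HasSect2FormAtZS` at the inductive assumptions `Sect2.LawsRT … k` — the unfolding of `SLaw₁₃CoPH θ p k` by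
def-T's `sLaw₁₃CoPH_iff`), a candidate 𝐓-image family `(tT, EkT)` over the sequences of length `k+1` which is
(i) UNIVERSAL in its 𝐄-component; (ii) at every NO-EXPANSION sequence `Ω_{k+1}(s′) = ∅` keeps the old terms of `t (init s′)` at the levels `≤ k`, has no
`𝐑^{(k+1)} ∕ 𝐁^{(k+1)}` and `E_{k+1}(s′) = E_k(init s′)`; (iii) at every EXPANSION sequence `Ω_{k+1}(s′) ≠ ∅` obeys the 𝐓-image laws `Sect2.LawsT … k` AND the 𝐓-image
clause — `𝐓ρ_k(s′) ≡ 0`, or `𝐓ρ_k(s′) = 𝐓_k(s′)[W(s′)] exp A_{k+1}(s′)[tT s′, EkT s′]` a.e. on the support of `χ_{k+1}(s′)`.  (iii) IS [III] Sect. 1 ∕ §3 ∕ Thm 2; (i)–(ii) are the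
candidate's bookkeeping.  A PREDICATE WITH PARAMETERS naming a deliverable — NOT claimed for any `θ`; at `rePinH θ` it is this seat's p566247 hypothesis block verbatim.
[cite: Balaban1988Convergent, Theorem p.245, §2 p.262, §3 p.279, (2.17)–(2.18) p.257, (2.25)–(2.27) p.259, (3.24)–(3.25) p.270] -/
def Sect3SupplyAt (θ : Stage13HParams F N) (p : B12.RunParams) (k : ℕ) : Prop :=
  ∀ (t : SeqOfRecord F θ.ν θ.τ9.M (gOfRecord₁₃ F N θ.toStage13Params p) p.K k → Sect2.TermValues (F.P p.K) (MatA N) (FluctV N) θ.τ9.M) (Ek : SeqOfRecord F θ.ν θ.τ9.M (gOfRecord₁₃ F N θ.toStage13Params p) p.K k → ℝ),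
    HasSect2FormAtZS F N (FluctV N) p.K (settingOfRecord₁₃ F N θ.toStage13Params p) k (θ.rzAt p) (WtOfRecord₁₃H F N θ p) (UbgOfRecord₁₃CoP F N θ.toStage13Params p k)
      (fun s u => Sect2.LawsRT (sect2TowerOfRecord F N (FluctV N) p.K (settingOfRecord₁₃ F N θ.toStage13Params p) (θ.rzAt p s) s u) (settingOfRecord₁₃ F N θ.toStage13Params p).lf k)
      (slotsOfRecord F N θ.ν θ.τ9 (EOfRecord₁₃ F N θ.toStage13Params) (wOfRecord₉ F N θ.toStage9Params) θ.ppSel p (gOfRecord₁₃ F N θ.toStage13Params p) k) t Ek →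
    ∃ (tT : SeqOfRecord F θ.ν θ.τ9.M (gOfRecord₁₃ F N θ.toStage13Params p) p.K (k + 1) → Sect2.TermValues (F.P p.K) (MatA N) (FluctV N) θ.τ9.M) (EkT : SeqOfRecord F θ.ν θ.τ9.M (gOfRecord₁₃ F N θ.toStage13Params p) p.K (k + 1) → ℝ),
      Sect2.UniversalE tT ∧
      (∀ s : SeqOfRecord F θ.ν θ.τ9.M (gOfRecord₁₃ F N θ.toStage13Params p) p.K (k + 1), s.Ω (k + 1) = ∅ →
        (∀ j, j ≤ k → ∀ X z g φ, (tT s).E j X z g φ = (t s.init).E j X z g φ) ∧ (∀ j, j ≤ k → ∀ X φ, (tT s).R j X φ = (t s.init).R j X φ) ∧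
        (∀ j, j ≤ k → ∀ X φ a, (tT s).B j X φ a = (t s.init).B j X φ a) ∧
        (∀ X φ, (tT s).R (k + 1) X φ = 0) ∧ (∀ X φ a, (tT s).B (k + 1) X φ a = 0) ∧ EkT s = Ek s.init) ∧
      (∀ s : SeqOfRecord F θ.ν θ.τ9.M (gOfRecord₁₃ F N θ.toStage13Params p) p.K (k + 1), s.Ω (k + 1) ≠ ∅ →
        Sect2.LawsT (sect2TowerOfRecord F N (FluctV N) p.K (settingOfRecord₁₃ F N θ.toStage13Params p) (θ.rzAt p s) s (tT s)) (settingOfRecord₁₃ F N θ.toStage13Params p).lf (settingOfRecord₁₃ F N θ.toStage13Params p).βc k ∧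
        (slotsTOfRecord F N θ.ν θ.τ9 (EOfRecord₁₃ F N θ.toStage13Params) (wOfRecord₉ F N θ.toStage9Params) θ.ppSel p
            (gOfRecord₁₃ F N θ.toStage13Params p) (k + 1) s = 0 ∨
          ∀ᵐ V' ∂fieldMeasure (F.P p.K) (k + 1) (SU N),
            chiSeqOfRecord F N θ.ν θ.τ9.M (gOfRecord₁₃ F N θ.toStage13Params p) p.K (k + 1) s V' ≠ 0 →
              slotsTOfRecord F N θ.ν θ.τ9 (EOfRecord₁₃ F N θ.toStage13Params) (wOfRecord₉ F N θ.toStage9Params) θ.ppSel p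
                  (gOfRecord₁₃ F N θ.toStage13Params p) (k + 1) s V' =
                sect2Slot F N (FluctV N) p.K (settingOfRecord₁₃ F N θ.toStage13Params p) (θ.rzAt p s) (WtOfRecord₁₃H F N θ p s) s (tT s) (EkT s)
                  (UbgOfRecord₁₃CoP F N θ.toStage13Params p (k + 1) s) V'))

/-- **THE NO-EXPANSION 𝐓-STEP AT LEVEL `k`** for the run `p` at the v1.7 parameter `θ` (the run's own `θ.rzAt p` ∕ `WtOfRecord₁₃H θ p`), AS ONE NAMED PREDICATE — dag-n11-d's
lane (the large-field ∕ no-expansion branch of the Theorem of p. 245: (3.24)–(3.25) with NO new terms): IF `ρ_k` has the §2 form (`SLaw₁₃CoPH θ p k`) THEN for SOME exposed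
witness `(t, E_k)` of that form the 𝐓-IMAGE CLAUSE holds at EVERY NO-EXPANSION sequence `Ω_{k+1}(s′) = ∅` for the OLD terms `(t (init s′), E_k(init s′))` — `𝐓ρ_k(s′) ≡ 0`, or
`𝐓ρ_k(s′) = 𝐓_k(s′)[W(s′)] exp A_{k+1}(s′)[t (init s′), E_k(init s′)]` a.e. on the support of `χ_{k+1}(s′)`.  A predicate with parameters naming a deliverable; NOT claimed here
for any `θ`: at `rePinH θ` dag-n11-d's `…N11FluctTruncation.exists_local_witness_clause_succ_rePinH_of_sLaw₁₃CoPH` delivers it MODULO the old-branch measurability ∕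
integrability of its `k`-local witness (their doors d2 ∕ d3 in flight); on the all-large diagonal it holds outright (p565431's lineage).
[cite: Balaban1988Convergent, Theorem p.245, (3.24)–(3.25) p.270, (2.17)–(2.18) p.257, §2 p.262] -/
def NoExpansionTStepAt (θ : Stage13HParams F N) (p : B12.RunParams) (k : ℕ) : Prop :=
  SLaw₁₃CoPH F N θ p k →
    ∃ (t : SeqOfRecord F θ.ν θ.τ9.M (gOfRecord₁₃ F N θ.toStage13Params p) p.K k → Sect2.TermValues (F.P p.K) (MatA N) (FluctV N) θ.τ9.M) (Ek : SeqOfRecord F θ.ν θ.τ9.M (gOfRecord₁₃ F N θ.toStage13Params p) p.K k → ℝ),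
      HasSect2FormAtZS F N (FluctV N) p.K (settingOfRecord₁₃ F N θ.toStage13Params p) k (θ.rzAt p) (WtOfRecord₁₃H F N θ p) (UbgOfRecord₁₃CoP F N θ.toStage13Params p k)
        (fun s u => Sect2.LawsRT (sect2TowerOfRecord F N (FluctV N) p.K (settingOfRecord₁₃ F N θ.toStage13Params p) (θ.rzAt p s) s u) (settingOfRecord₁₃ F N θ.toStage13Params p).lf k)
        (slotsOfRecord F N θ.ν θ.τ9 (EOfRecord₁₃ F N θ.toStage13Params) (wOfRecord₉ F N θ.toStage9Params) θ.ppSel p (gOfRecord₁₃ F N θ.toStage13Params p) k) t Ek ∧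
      ∀ s : SeqOfRecord F θ.ν θ.τ9.M (gOfRecord₁₃ F N θ.toStage13Params p) p.K (k + 1), s.Ω (k + 1) = ∅ →
        slotsTOfRecord F N θ.ν θ.τ9 (EOfRecord₁₃ F N θ.toStage13Params) (wOfRecord₉ F N θ.toStage9Params) θ.ppSel p
            (gOfRecord₁₃ F N θ.toStage13Params p) (k + 1) s = 0 ∨
          ∀ᵐ V' ∂fieldMeasure (F.P p.K) (k + 1) (SU N),
            chiSeqOfRecord F N θ.ν θ.τ9.M (gOfRecord₁₃ F N θ.toStage13Params p) p.K (k + 1) s V' ≠ 0 →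
              slotsTOfRecord F N θ.ν θ.τ9 (EOfRecord₁₃ F N θ.toStage13Params) (wOfRecord₉ F N θ.toStage9Params) θ.ppSel p
                  (gOfRecord₁₃ F N θ.toStage13Params p) (k + 1) s V' =
                sect2Slot F N (FluctV N) p.K (settingOfRecord₁₃ F N θ.toStage13Params p) (θ.rzAt p s) (WtOfRecord₁₃H F N θ p s) s (t s.init) (Ek s.init)
                  (UbgOfRecord₁₃CoP F N θ.toStage13Params p (k + 1) s) V'

end Supply

end Summit.QuantumFields.YangMills.Theorems.BalabanUVNodesN11Sect3SupplyDefs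

end
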